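import Summits.ValiantsHypothesis.ValiantsHypothesis.Theorems.GrenetZeonDualUnipotentThreeHalvesHeavyTopHalfSpeedPacking

/-!
# `GrenetZeon.DualUnipotentThreeHalves` (stmt-ValiantsHypothesis-24318), LINE β `half_speed`, K1 (iii) GROUPING KEY — the matrix-free
# coarsening of the Jordan–Hölder levels into «fat singletons + short kill runs» by ONE monotone key (no greedy recursion)

First inheritor val-port-2 g2 (desk #332; port-3 README (iii) step 2).  Levels `t < L` with sizes `g t`, `D = Σ g`, target height `Θ`;
`fat t :⟺ 4D ≤ Θ·g t`.  Put `F t := #{t' < t : fat t'}`, `S t := Σ_{t' < t, ¬fat t'} g t'` (small mass below `t`) and the KEY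
`κ t := 2·(Θ·S t/(4D) + F t) + [fat t]`.  Then (this file): `κ` is MONOTONE (`key_mono`), a fat level shares its key with nobody
(`key_ne_of_fat` — parity / jump by 2), two small levels with the same key have the same `F` and the same quotient (`key_eq_small`), hence
lie in ONE run with `Θ·(S t₂ − S t₁) < 4D` (`small_mass_lt`), and the keys of small levels take at most `Θ/4 + #fat + 1` values
(`card_small_keys_le`).  Composing the flipped JH level function with `κ` (and compressing the key values to `Fin L'` by
`Finset.orderIsoOfFin`) is the coarse level function `μ` the loop ✓ `exists_halfSpeed_chain` consumes; ✓ `blockUpper_of_monotone` keeps the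
block shape; ✓ `packing_height` / `packing_codim` take exactly the outputs of this file as `hfew` / `Θ·g < 8D`.

Honest framing.  Combinatorics (`--supports stmt-ValiantsHypothesis-24318 --as helper`); proves nothing about K1, `HalfSpeedIrrLaw`, R2, the
crux, 8062 or `VP ≠ VNP` — all OPEN / NOT proved.
-/

set_option linter.dupNamespace false
set_option autoImplicit false

namespace Summit.ValiantsHypothesis.ValiantsHypothesis.Theorems.GrenetZeon.HalfSpeed

open scoped BigOperators

section Key

variable (Θ D : ℕ) (g : ℕ → ℕ)

/-- Fat levels: `4D ≤ Θ·g t` (reducible, so decidability is inherited from `ℕ`). -/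
abbrev Fat (t : ℕ) : Prop := 4 * D ≤ Θ * g t

/-- Number of fat levels below `t`. -/
def fatBelow (t : ℕ) : ℕ := ((Finset.range t).filter fun t' => Fat Θ D g t').card

/-- Small mass below `t`. -/
def smallBelow (t : ℕ) : ℕ := ∑ t' ∈ (Finset.range t).filter (fun t' => ¬ Fat Θ D g t'), g t'

/-- THE KEY `κ t = 2·(Θ·S t/(4D) + F t) + [fat t]`. -/
def key (t : ℕ) : ℕ :=
  2 * (Θ * smallBelow Θ D g t / (4 * D) + fatBelow Θ D g t) + if Fat Θ D g t then 1 else 0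

/-- `F` is monotone. -/
theorem fatBelow_mono {t t' : ℕ} (h : t ≤ t') : fatBelow Θ D g t ≤ fatBelow Θ D g t' := by
  unfold fatBelow
  exact Finset.card_le_card (Finset.filter_subset_filter _ (Finset.range_mono h))

/-- `S` is monotone. -/
theorem smallBelow_mono {t t' : ℕ} (h : t ≤ t') : smallBelow Θ D g t ≤ smallBelow Θ D g t' := by
  unfold smallBelow
  exact Finset.sum_le_sum_of_subset (Finset.filter_subset_filter _ (Finset.range_mono h))

/-- A fat level strictly below `t'` is counted: `F t + 1 ≤ F t'`. -/
theorem fatBelow_lt_of_fat {t t' : ℕ} (h : t < t') (hf : Fat Θ D g t) : fatBelow Θ D g t + 1 ≤ fatBelow Θ D g t' := by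
  unfold fatBelow
  have hsub : insert t ((Finset.range t).filter fun t' => Fat Θ D g t') ⊆ (Finset.range t').filter fun t' => Fat Θ D g t' := by
    intro x hx
    rw [Finset.mem_insert] at hx
    rw [Finset.mem_filter, Finset.mem_range]
    rcases hx with rfl | hx
    · exact ⟨h, hf⟩
    · rw [Finset.mem_filter, Finset.mem_range] at hx
      exact ⟨hx.1.trans h, hx.2⟩
  have hnot : t ∉ (Finset.range t).filter fun t' => Fat Θ D g t' := by simp
  have := Finset.card_le_card hsub
  rwa [Finset.card_insert_of_notMem hnot] at this

/-- **The key is monotone.** -/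
theorem key_mono {t t' : ℕ} (h : t ≤ t') : key Θ D g t ≤ key Θ D g t' := by
  unfold key
  have hS := Nat.div_le_div_right (c := 4 * D) (Nat.mul_le_mul_left Θ (smallBelow_mono Θ D g h))
  rcases eq_or_lt_of_le h with rfl | hlt
  · exact le_rfl
  · by_cases hf : Fat Θ D g t
    · have hF := fatBelow_lt_of_fat Θ D g hlt hf
      rw [if_pos hf]
      have : (if Fat Θ D g t' then 1 else 0) ≥ 0 := Nat.zero_le _
      omega
    · rw [if_neg hf]
      have hF := fatBelow_mono Θ D g h
      have : (if Fat Θ D g t' then 1 else 0) ≥ 0 := Nat.zero_le _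
      omega

/-- **A fat level is alone in its key class.** -/
theorem key_ne_of_fat {t t' : ℕ} (hf : Fat Θ D g t) (hne : t ≠ t') : key Θ D g t ≠ key Θ D g t' := by
  intro heq
  unfold key at heq
  rw [if_pos hf] at heq
  by_cases hf' : Fat Θ D g t'
  · rw [if_pos hf'] at heq
    rcases lt_or_gt_of_ne hne with hlt | hgt
    · have hF := fatBelow_lt_of_fat Θ D g hlt hf
      have hS := Nat.div_le_div_right (c := 4 * D) (Nat.mul_le_mul_left Θ (smallBelow_mono Θ D g hlt.le))
      omega
    · have hF := fatBelow_lt_of_fat Θ D g hgt hf'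
      have hS := Nat.div_le_div_right (c := 4 * D) (Nat.mul_le_mul_left Θ (smallBelow_mono Θ D g hgt.le))
      omega
  · rw [if_neg hf'] at heq
    omega

/-- **Two small levels with the same key have the same fat count and the same quotient.** -/
theorem key_eq_small {t₁ t₂ : ℕ} (h : t₁ ≤ t₂) (h₁ : ¬ Fat Θ D g t₁) (h₂ : ¬ Fat Θ D g t₂)
    (heq : key Θ D g t₁ = key Θ D g t₂) :
    fatBelow Θ D g t₁ = fatBelow Θ D g t₂ ∧
      Θ * smallBelow Θ D g t₁ / (4 * D) = Θ * smallBelow Θ D g t₂ / (4 * D) := by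
  unfold key at heq
  rw [if_neg h₁, if_neg h₂] at heq
  have hF := fatBelow_mono Θ D g h
  have hS := Nat.div_le_div_right (c := 4 * D) (Nat.mul_le_mul_left Θ (smallBelow_mono Θ D g h))
  omega

/-- **Equal quotients bound the mass between**: `Θ·(S t₂ − S t₁) < 4D` (for `D > 0`). -/
theorem small_mass_lt {t₁ t₂ : ℕ} (h : t₁ ≤ t₂) (hD : 0 < D)
    (hq : Θ * smallBelow Θ D g t₁ / (4 * D) = Θ * smallBelow Θ D g t₂ / (4 * D)) :
    Θ * (smallBelow Θ D g t₂ - smallBelow Θ D g t₁) < 4 * D := by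
  have h1 := Nat.div_add_mod (Θ * smallBelow Θ D g t₁) (4 * D)
  have h2 := Nat.div_add_mod (Θ * smallBelow Θ D g t₂) (4 * D)
  have h3 := Nat.mod_lt (Θ * smallBelow Θ D g t₂) (by omega : 0 < 4 * D)
  have hS := smallBelow_mono Θ D g h
  rw [Nat.mul_sub]
  rw [hq] at h1
  have : Θ * smallBelow Θ D g t₁ ≤ Θ * smallBelow Θ D g t₂ := Nat.mul_le_mul_left Θ hS
  omega

/-- **Equal fat count ⇒ no fat level in between.** -/
theorem not_fat_of_fatBelow_eq {t₁ t₂ t : ℕ} (h₁ : t₁ ≤ t) (h₂ : t < t₂)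
    (heq : fatBelow Θ D g t₁ = fatBelow Θ D g t₂) : ¬ Fat Θ D g t := by
  intro hf
  have a := fatBelow_mono Θ D g h₁
  have b := fatBelow_lt_of_fat Θ D g h₂ hf
  omega

/-- Small mass telescopes over a run of small levels: `S t₂ + g t₂ − S t₁ = Σ_{t₁ ≤ t ≤ t₂} g t` when no level in `[t₁, t₂]` is fat. -/
theorem smallBelow_succ_sub {t₁ t₂ : ℕ} (h : t₁ ≤ t₂) (hrun : ∀ t, t₁ ≤ t → t ≤ t₂ → ¬ Fat Θ D g t) :
    smallBelow Θ D g (t₂ + 1) = smallBelow Θ D g t₁ + ∑ t ∈ Finset.Ico t₁ (t₂ + 1), g t := by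
  unfold smallBelow
  have hsplit : (Finset.range (t₂ + 1)).filter (fun t' => ¬ Fat Θ D g t') =
      (Finset.range t₁).filter (fun t' => ¬ Fat Θ D g t') ∪ Finset.Ico t₁ (t₂ + 1) := by
    ext x
    simp only [Finset.mem_filter, Finset.mem_range, Finset.mem_union, Finset.mem_Ico]
    constructor
    · rintro ⟨hx, hnf⟩
      by_cases hx1 : x < t₁
      · exact Or.inl ⟨hx1, hnf⟩
      · exact Or.inr ⟨by omega, hx⟩
    · rintro (⟨hx, hnf⟩ | ⟨hx1, hx2⟩)
      · exact ⟨by omega, hnf⟩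
      · exact ⟨hx2, hrun x hx1 (by omega)⟩
  rw [hsplit, Finset.sum_union]
  rw [Finset.disjoint_left]
  intro x hx hx'
  rw [Finset.mem_filter, Finset.mem_range] at hx
  rw [Finset.mem_Ico] at hx'
  omega

/-- ★ **SHORT KILL RUNS.**  If `t₁ ≤ t₂` are small levels with the same key (and `D > 0`), then every level in `[t₁, t₂]` is small and
`Θ · Σ_{t₁ ≤ t ≤ t₂} g t < 8D`. -/
theorem run_mass_lt {t₁ t₂ : ℕ} (h : t₁ ≤ t₂) (hD : 0 < D) (h₁ : ¬ Fat Θ D g t₁) (h₂ : ¬ Fat Θ D g t₂)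
    (heq : key Θ D g t₁ = key Θ D g t₂) :
    (∀ t, t₁ ≤ t → t ≤ t₂ → ¬ Fat Θ D g t) ∧ Θ * ∑ t ∈ Finset.Ico t₁ (t₂ + 1), g t < 8 * D := by
  obtain ⟨hF, hq⟩ := key_eq_small Θ D g h h₁ h₂ heq
  have hrun : ∀ t, t₁ ≤ t → t ≤ t₂ → ¬ Fat Θ D g t := by
    intro t ht1 ht2
    rcases eq_or_lt_of_le ht2 with rfl | hlt
    · exact h₂
    · exact not_fat_of_fatBelow_eq Θ D g ht1 hlt hF
  refine ⟨hrun, ?_⟩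
  have htel := smallBelow_succ_sub Θ D g h hrun
  have hmass := small_mass_lt Θ D g h hD hq
  -- S(t₂+1) = S t₂ + g t₂ (t₂ small)
  have hstep : smallBelow Θ D g (t₂ + 1) = smallBelow Θ D g t₂ + g t₂ := by
    have := smallBelow_succ_sub Θ D g (le_refl t₂) (fun t ht1 ht2 => by
      have : t = t₂ := le_antisymm ht2 ht1
      subst this; exact h₂)
    simpa using this
  have hsmall₂ : Θ * g t₂ < 4 * D := lt_of_not_ge h₂
  have hS := smallBelow_mono Θ D g h
  have e1 : ∑ t ∈ Finset.Ico t₁ (t₂ + 1), g t = smallBelow Θ D g t₂ + g t₂ - smallBelow Θ D g t₁ := by omega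
  rw [e1]
  have e2 : smallBelow Θ D g t₂ + g t₂ - smallBelow Θ D g t₁ = (smallBelow Θ D g t₂ - smallBelow Θ D g t₁) + g t₂ := by omega
  rw [e2, Nat.mul_add]
  omega

/-- Small mass is bounded by the total mass of the first `L` levels (for `t ≤ L`). -/
theorem smallBelow_le_sum {t L : ℕ} (h : t ≤ L) : smallBelow Θ D g t ≤ ∑ t' ∈ Finset.range L, g t' := by
  unfold smallBelow
  exact Finset.sum_le_sum_of_subset ((Finset.filter_subset _ _).trans (Finset.range_mono h))

/-- ★ **FEW KILL CLASSES.**  The keys of the small levels `< L` take at most `Θ/4 + #fat + 1` values (`Σ_{t<L} g = D > 0`). -/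
theorem card_small_keys_le (L : ℕ) (hsum : ∑ t ∈ Finset.range L, g t = D) (hD : 0 < D) :
    (((Finset.range L).filter fun t => ¬ Fat Θ D g t).image (key Θ D g)).card ≤ Θ / 4 + fatBelow Θ D g L + 1 := by
  -- every small key is `2·v` with `v ≤ Θ/4 + F L`
  have hval : ∀ t ∈ (Finset.range L).filter (fun t => ¬ Fat Θ D g t),
      key Θ D g t ∈ (Finset.range (Θ / 4 + fatBelow Θ D g L + 1)).image (fun v => 2 * v) := by
    intro t ht
    rw [Finset.mem_filter, Finset.mem_range] at ht
    rw [Finset.mem_image]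
    refine ⟨Θ * smallBelow Θ D g t / (4 * D) + fatBelow Θ D g t, ?_, ?_⟩
    · rw [Finset.mem_range]
      have hq : Θ * smallBelow Θ D g t / (4 * D) ≤ Θ / 4 := by
        calc Θ * smallBelow Θ D g t / (4 * D) ≤ Θ * D / (4 * D) :=
              Nat.div_le_div_right (Nat.mul_le_mul_left Θ ((smallBelow_le_sum Θ D g ht.1.le).trans hsum.le))
          _ = Θ / 4 := by rw [mul_comm 4 D, ← Nat.div_div_eq_div_mul, Nat.mul_div_cancel _ hD]
      have hF := fatBelow_mono Θ D g ht.1.le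
      omega
    · unfold key; rw [if_neg ht.2]; ring
  calc (((Finset.range L).filter fun t => ¬ Fat Θ D g t).image (key Θ D g)).card
      ≤ ((Finset.range (Θ / 4 + fatBelow Θ D g L + 1)).image (fun v => 2 * v)).card :=
        Finset.card_le_card (Finset.image_subset_iff.2 hval)
    _ ≤ (Finset.range (Θ / 4 + fatBelow Θ D g L + 1)).card := Finset.card_image_le
    _ = Θ / 4 + fatBelow Θ D g L + 1 := Finset.card_range _

end Key

end Summit.ValiantsHypothesis.ValiantsHypothesis.Theorems.GrenetZeon.HalfSpeed
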